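import Summits.BirchSwinnertonDyer.BirchSwinnertonDyer.Theorems.QuadraticBranchSignedControlPlusEtaNonsurjThetaFunctionalEquationNormCoordinateSqueeze
import Summits.BirchSwinnertonDyer.BirchSwinnertonDyer.Theorems.QuadraticBranchSignedControlPlusEtaLowerInclusionFunctionalEquationSqueeze
import HarnessLib

/-!
# Route `QuadraticBranchSignedControl` (rung K8, cell `bsd-potss`), residual crux `PlusEtaMainConjectureNonsurj`
# (stmt-BirchSwinnertonDyer-19606) and crux `PlusEtaLowerInclusion` (stmt-BirchSwinnertonDyer-19601): THE FUNCTIONAL EQUATION ON THE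
# QUADRATIC BRANCH, XXXVI — THE FUNCTIONAL-EQUATION SQUEEZE ROAD WITHOUT RATIONAL ZEROS: k8eta-c1 g11's road
# `quadraticBranchPlusEta_pair_of_namedFacts_of_invol_of_feShape_of_torsionDvd` with its analytic shape `hshape`
# (`Lη = u·T^r·(T − c₁)(T − c₂)`, `c_i ∈ pℤ_p ∖ {0}`) REPLACED by **`Lη = u·T^r·(1+T)^k·H(T + ιT)`, `H ∈ ℤ_p[Z]` distinguished IRREDUCIBLE,
# `H(0) ≠ 0`** (any `k ≥ 1`) — at `k = 1`: **`Lη = u·T^r·(T² + aT + a)`, `a ∈ pℤ_p ∖ {0}`**, with NO condition on the zeros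
# (seat `bsd-potss-k8eta-c2` g31; kernel; CONDITIONAL on the same named facts as g11's road)

WHY. The g11 road (`…PlusEtaLowerInclusionFunctionalEquationSqueeze`) proves (E⁺_η) ∧ (C1⁺_η) at a tower-onto pair from Kobayashi 1.2/1.3/2.2η/4.1η,
Kitajima–Otsuki 1.3η, Kim 3.11η (named facts), `ρ_{V,p^∞}` onto, the `V`-certificate, ONE factor of `p` in `#(X_η/TX_η)_tors`, and the analytic
shape `hshape` whose two extra zeros must be `ℤ_p`-RATIONAL. Part XXXV's brick `span_eq_of_normShape_of_irreducible` needs instead that the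
norm polynomial `H_an ∈ ℤ_p[Z]` be IRREDUCIBLE — automatic at `k = 1` (`λ = r + 2`: the Weierstrass polynomial is `T^r(T² + aT + a)` by Part XVII,
`H_an = Z + a`), and decided by one or two digits at `k = 2` (Part XXXIV). THIS FILE re-runs g11's chain VERBATIM with the brick swapped:
Thm. 2.2η (f.g. torsion, generator `g`), Thm. 4.1η + onto (`g ∣ Lη`), the rank bound (`T^r ∣ g`), leading coefficient = unit · `#coker` of the
Bockstein map and `#(X_η/TX_η)_tors ∣ #coker` (`p ∣ coeff_r g`), Kim 3.11η (`(ιg) = (g)`), Part XXXV. Consequence for the census: the road now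
applies IN SHAPE to all 19 `k = 1` level-4 rows of P-30Z (12 of which have `T² + aT + a` irreducible over `ℚ_5`, where `hshape` is void) and to the
8 irreducible `k = 2` rows of P-31F, each still needing its algebraic factor of `p` and the tower-onto hypothesis (crux 19601's rows; on crux
19606's non-onto rows Part XXXV's slack version gives the polynomial equality up to `p^{μ}` instead).

WHAT (3 theorems, all CONDITIONAL on the displayed named facts; frame = g11's, word for word). `coeff_ne_zero_of_normShape'` (the `coeff_r Lη ≠ 0`
slot from the shape), **`quadraticBranchPlusEta_pair_of_namedFacts_of_invol_of_normShape_of_torsionDvd`** (shape `u·T^r·(1+T)^{deg H}·H(T + ιT)`,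
`H` distinguished irreducible, `H(0) ≠ 0` ⟹ (E⁺_η) ∧ (C1⁺_η)), **`quadraticBranchPlusEta_pair_of_namedFacts_of_invol_of_quadraticShape_of_torsionDvd`**
(`k = 1`: shape `u·T^r·(T² + aT + a)`, `p ∣ a`, `a ≠ 0`).

HONEST FRAMING (cell `bsd-potss`; FULL-BSD rank ≤ 1 programme, HUMAN RULING D-0036/D-0074): TOOL THEOREMS ONLY, CONDITIONAL on the named
Literature facts in hypothesis position (Kobayashi 2003 Thm. 1.2/1.3/2.2η/4.1η, Kitajima–Otsuki 2018 Thm. 1.3η, B. D. Kim 2008 Thm. 3.11η), on the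
tower-onto hypothesis, the `V`-certificate, the per-pair analytic shape and the per-pair algebraic factor of `p` (supplied here for NO pair). No
definition, no named fact minted, no `sorry`, axioms standard; cruxes 19601 / 19606 and the route are OPEN and NOT closed; nothing is booked;
`BSD(W, p)` is claimed for no pair. `--supports stmt-BirchSwinnertonDyer-19606`; bears on 19601 (successor of k8eta-c1: the `hshape` input of the
g11 road can be weakened to the Weierstrass polynomial `T^r(T² + aT + a)` alone).

References: [KimBD2008MRL] Thm. 3.11 (p. 93); [Kobayashi2003] Thm. 2.2 (p. 5), §4 + Thm. 4.1 (p. 8); [KitajimaOtsuki2018] Thm. 1.3; [Washington1997]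
§7.1, §13.2; [MazurTateTeitelbaum1986Invent] §I.17. Tree: Part XXXV; k8eta-c1 g3/g10/g11 files `…PlusEtaLowerInclusionValuationSqueeze*`,
`…PlusEtaLowerInclusionFunctionalEquationSqueeze`.
-/

set_option autoImplicit false
set_option linter.dupNamespace false

noncomputable section

open scoped Classical

open CongruenceSubgroup Field NumberField WeierstrassCurve
open Literature.NumberTheory.EllipticCurves
open Literature.NumberTheory.EllipticCurves.ModularForms
open Literature.NumberTheory.GaloisRepresentations
open Literature.NumberTheory.EllipticCurves.IwasawaAlgebra
open Summit.BirchSwinnertonDyer.Rank1Residual.Additive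

namespace Summit.BirchSwinnertonDyer.BirchSwinnertonDyer.Theorems.EtaThetaFunctionalEquation

section Pair

variable {V : WeierstrassCurve ℚ} [V.IsElliptic] [V.IsGloballyMinimal] {p : ℕ} [hp : Fact p.Prime]

/-- The `coeff_r Lη ≠ 0` slot of g11's road from the norm shape: `coeff_r(u·T^r·(1+T)^k·H(T + ιT)) = u(0)·H(0) ≠ 0`. [cite: Washington1997, §7.1] -/
theorem coeff_ne_zero_of_normShape' {Lη u : IwasawaAlgebra p} {r₀ : ℕ} {H : Polynomial ℤ_[p]} (hu : IsUnit u) (hH0 : H.coeff 0 ≠ 0)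
    (hL : Lη = u * PowerSeries.X ^ r₀ * ((1 + PowerSeries.X) ^ H.natDegree *
      PowerSeries.subst (PowerSeries.X + invol p PowerSeries.X) (H : IwasawaAlgebra p))) :
    PowerSeries.coeff r₀ Lη ≠ 0 := by
  have hH0' : PowerSeries.constantCoeff (H : IwasawaAlgebra p) ≠ 0 := by
    rwa [← PowerSeries.coeff_zero_eq_constantCoeff_apply, Polynomial.coeff_coe]
  rw [hL, coeff_normShape rfl]
  exact mul_ne_zero (PowerSeries.isUnit_iff_constantCoeff.mp hu).ne_zero hH0'

/-- **(E⁺_η) ∧ (C1⁺_η) AT A TOWER-ONTO PAIR — the functional-equation squeeze WITHOUT RATIONAL ZEROS.** g11's road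
(`quadraticBranchPlusEta_pair_of_namedFacts_of_invol_of_feShape_of_torsionDvd`) with the analytic shape weakened to
**`Lη = u·T^r·(1+T)^{deg H}·H(T + ιT)`, `u ∈ Λˣ`, `H ∈ ℤ_p[Z]` distinguished and IRREDUCIBLE with `H(0) ≠ 0`** (`r = rank V^{(p*)}(ℚ)`; for every
branch function — they differ by units): GRANTED Kobayashi's Thm. 1.2 / 1.3 / 2.2(η) / 4.1(η), Kitajima–Otsuki's Thm. 1.3 at `η` and B. D. Kim's
Thm. 3.11 at `η` (NAMED facts, hypothesis position), `p ≥ 5` good with `a_p = 0`, `ρ_{V,p^m}` onto, the `V`-certificate and ONE factor of `p` in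
`#(X_η/TX_η)_tors` (`htors`): (E⁺_η)(V,p) ∧ (C1⁺_η)(V,p). Chain = g11's, last step = Part XXXV `span_eq_of_normShape_of_irreducible`.
CONDITIONAL on the displayed inputs; closes nothing class-wide; certifies no row by itself. [cite: KimBD2008MRL, Thm. 3.11 (p. 93)]
[cite: Kobayashi2003, Thm. 2.2 (p. 5), Thm. 4.1 and §4 (p. 8)] [cite: KitajimaOtsuki2018, Thm. 1.3] -/
theorem quadraticBranchPlusEta_pair_of_namedFacts_of_invol_of_normShape_of_torsionDvd
    (h12 : Kobayashi2003.thm12_signedSelmerDual_finite_torsion)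
    (h13 : Kobayashi2003.thm41_signedCharIdeal_divisibility)
    (h22 : Kobayashi2003.thm22_etaSignedSelmerDual_finite_torsion)
    (h41 : Kobayashi2003.thm41_plusEtaCharIdeal_dvd)
    (hKO : KitajimaOtsuki2018.mainThm13_etaSignedSelmerDual_noFiniteSubmodule)
    (hFE : Kim2008.thm311_etaSignedSelmerDual_charIdeal_map_invol)
    (hp5 : 5 ≤ p) (hgood : V.HasGoodReductionAtPrime p) (hap : V.frobeniusTrace p = 0)
    (hsurj : ∀ m : ℕ, V.HasSurjectiveModNGaloisRep (p ^ m : ℕ))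
    (hcertV : ∀ {N : ℕ} [NeZero N] (f : CuspForm (Gamma0 N) 2), IsNewformOf V f →
      ∃ L : IwasawaAlgebra p, Kobayashi2003.IsSignedPAdicLFunction f p 1 L ∧
        IsUnit (PowerSeries.coeff V.mordellWeilRank L))
    (hHshape : ∀ {N : ℕ} [NeZero N] {f : CuspForm (Gamma0 N) 2}, IsNewformOf V f →
      ∀ (ϖ : ℚ), (if Even (p / 2) then (ϖ : ℝ) * V.realPeriodRat = plusPeriod f
          else (ϖ : ℝ) * V.imaginaryPeriodRat = minusPeriod f) →
      ∀ (Lη : IwasawaAlgebra p), IsQuadraticBranchPlusLFunction f p ϖ Lη →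
        ∃ (u : IwasawaAlgebra p) (H : Polynomial ℤ_[p]), IsUnit u ∧ H.IsDistinguishedAt (IsLocalRing.maximalIdeal ℤ_[p]) ∧
          Irreducible H ∧ H.coeff 0 ≠ 0 ∧
          Lη = u * PowerSeries.X ^ (V.quadraticTwist ((-1) ^ (p / 2) * p)).mordellWeilRank *
            ((1 + PowerSeries.X) ^ H.natDegree * PowerSeries.subst (PowerSeries.X + invol p PowerSeries.X) (H : IwasawaAlgebra p)))
    (htors : ∀ (K₀ : Type) [Field K₀] [NumberField K₀] [IsCyclotomicExtension {p} ℚ K₀]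
      [(galRange (K := ℚ) K₀).Normal] (ηq : absoluteGaloisGroup ℚ →* ℤˣ),
      (∀ σ ∈ galRange (K := ℚ) K₀, ηq σ = 1) → ηq ≠ 1 →
      ∀ (κ : ZpExtension ℚ p) (γ : absoluteGaloisGroup ℚ),
        κ.IsCyclotomic → κ.IsTopGenerator γ → γ ∈ galRange (K := ℚ) K₀ → IsCyclotomicVariable p γ →
      ∀ {N : ℕ} [NeZero N] {f : CuspForm (Gamma0 N) 2}, IsNewformOf V f →
      ∀ (ϖ : ℚ), (if Even (p / 2) then (ϖ : ℝ) * V.realPeriodRat = plusPeriod f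
          else (ϖ : ℝ) * V.imaginaryPeriodRat = minusPeriod f) →
      ∀ (Lη : IwasawaAlgebra p), IsQuadraticBranchPlusLFunction f p ϖ Lη →
        PowerSeries.coeff (V.quadraticTwist ((-1) ^ (p / 2) * p)).mordellWeilRank Lη ≠ 0 →
      ∀ (D : EtaSignedSelmerDualData V κ K₀ ℚ_[p] ηq γ 1),
        p ∣ Nat.card (AddCommGroup.torsion (IwasawaAlgebra.coinvariants p D.X))) :
    QuadraticBranchPlusEtaLowerInclusionAt V p ∧ QuadraticBranchPlusEtaMainConjectureAt V p := by
  have hE : QuadraticBranchPlusEtaLowerInclusionAt V p := by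
    intro K₀ _ _ _ _ ηq hηK hη1 N _ f hp2 hgood' hap' hf ϖ hϖ Lη hL κ γ hκ hγ hγK hγc D
    obtain ⟨hfin, htor⟩ :=
      EtaSignedSelmerDualData.finite_isTorsion_of_thm22 h22 hηK hp2 hgood' hap' hκ hγ hγK D
    haveI : Module.Finite (IwasawaAlgebra p) D.X := hfin
    obtain ⟨g, hg⟩ := (charIdeal_isPrincipal_holds p D.X).principal
    have hg' : D.charIdeal = Ideal.span {g} := hg
    -- Kato side: `g ∣ Lη`
    obtain ⟨-, hup⟩ := EtaSignedSelmerDualData.thm41_plus_of_facts h22 h41 hηK hη1 hp2 hgood' hap' hf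
      ϖ hϖ Lη hL hκ hγ hγK hγc D
    have hgL : g ∣ Lη := by
      have h := hup hsurj
      rw [hg', Ideal.span_singleton_le_span_singleton] at h
      exact h
    -- the analytic shape and `coeff_r Lη ≠ 0`
    obtain ⟨u, H, hu, hH, hirr, hH0, hLs⟩ := hHshape hf ϖ hϖ Lη hL
    have hne : PowerSeries.coeff (V.quadraticTwist ((-1) ^ (p / 2) * p)).mordellWeilRank Lη ≠ 0 :=
      coeff_ne_zero_of_normShape' hu hH0 hLs
    -- rank bound, leading coefficient, torsion divisibility: `p ∣ coeff_r g`
    have hXg := X_pow_twistRank_dvd_etaCharGenerator_of_namedFacts_of_certV h12 h13 h22 hp5 hgood hap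
      hsurj (fun f hf => hcertV f hf) hf K₀ ηq hηK hη1 κ γ hκ hγ hγK hγc D hg'
    obtain ⟨w, hw⟩ := coeff_twistRank_etaCharGenerator_eq_unit_mul_card_coker_bockstein h12 h13 h22 h41
      hKO hp5 hgood hap hsurj (fun f hf => hcertV f hf) hf ϖ hϖ Lη hL hne K₀ ηq hηK hη1 κ γ hκ hγ hγK hγc
      D hg'
    obtain ⟨-, hdvd⟩ := ker_bockstein_eq_bot_and_natCard_torsion_coinvariants_dvd h12 h13 h22 h41 hKO
      hp5 hgood hap hsurj (fun f hf => hcertV f hf) hf ϖ hϖ Lη hL hne K₀ ηq hηK hη1 κ γ hκ hγ hγK hγc D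
    have hcoef : (p : ℤ_[p]) ∣
        PowerSeries.coeff (V.quadraticTwist ((-1) ^ (p / 2) * p)).mordellWeilRank g := by
      rw [hw]
      obtain ⟨c, hc⟩ := (htors K₀ ηq hηK hη1 κ γ hκ hγ hγK hγc hf ϖ hϖ Lη hL hne D).trans hdvd
      refine Dvd.dvd.mul_left ?_ _
      rw [hc, Nat.cast_mul]
      exact dvd_mul_right _ _
    -- the algebraic functional equation at `η` (B. D. Kim Thm. 3.11): `(g)` is `ι`-stable
    have hι : Ideal.span {invol p g} = Ideal.span {g} := by
      have h := hFE p K₀ ηq hηK V (by omega) hgood' hap' κ γ hκ hγ hγK 1 D.toLiterature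
      rw [EtaSignedSelmerDualData.charIdeal_toLiterature] at h
      exact span_invol_eq_of_map_invol_eq h hg'
    -- squeeze in the norm coordinate (Part XXXV)
    obtain ⟨r, hr⟩ := exists_two_mul_eq_neg_one (p := p) hp2
    have heq : Ideal.span {g} = Ideal.span {Lη} :=
      span_eq_of_normShape_of_irreducible hr (S := PowerSeries.X * PowerSeries.binomialSeries ℤ_[p] r) rfl
        (Z := PowerSeries.X + invol p PowerSeries.X) rfl hu hH hirr hH0 hLs hXg hgL hι hcoef
    rw [← heq, ← hg']
  exact ⟨hE, quadraticBranchPlusEtaMainConjectureAt_of_facts_of_surjective_of_etaLowerInclusion h22 h41 hsurj hE⟩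

/-- **(E⁺_η) ∧ (C1⁺_η) AT A TOWER-ONTO PAIR, `k = 1`: the shape `Lη = u·T^r·(T² + aT + a)`, `a ∈ pℤ_p ∖ {0}`** — g11's `hshape` asks for
`(T − c₁)(T − c₂)` with `c₁, c₂ ∈ pℤ_p ∖ {0}`; the Weierstrass polynomial of `L_p⁺(V, η, X)` at `λ = r + 2` is ALWAYS `T^r(T² + aT + a)` (Part XVII),
split over `ℤ_p` or not, and the squeeze goes through either way (`H = Z + a` is irreducible). Same named facts and inputs otherwise.
[cite: KimBD2008MRL, Thm. 3.11 (p. 93)] [cite: Kobayashi2003, Thm. 2.2 (p. 5), Thm. 4.1 and §4 (p. 8)] [cite: KitajimaOtsuki2018, Thm. 1.3] -/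
theorem quadraticBranchPlusEta_pair_of_namedFacts_of_invol_of_quadraticShape_of_torsionDvd
    (h12 : Kobayashi2003.thm12_signedSelmerDual_finite_torsion)
    (h13 : Kobayashi2003.thm41_signedCharIdeal_divisibility)
    (h22 : Kobayashi2003.thm22_etaSignedSelmerDual_finite_torsion)
    (h41 : Kobayashi2003.thm41_plusEtaCharIdeal_dvd)
    (hKO : KitajimaOtsuki2018.mainThm13_etaSignedSelmerDual_noFiniteSubmodule)
    (hFE : Kim2008.thm311_etaSignedSelmerDual_charIdeal_map_invol)
    (hp5 : 5 ≤ p) (hgood : V.HasGoodReductionAtPrime p) (hap : V.frobeniusTrace p = 0)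
    (hsurj : ∀ m : ℕ, V.HasSurjectiveModNGaloisRep (p ^ m : ℕ))
    (hcertV : ∀ {N : ℕ} [NeZero N] (f : CuspForm (Gamma0 N) 2), IsNewformOf V f →
      ∃ L : IwasawaAlgebra p, Kobayashi2003.IsSignedPAdicLFunction f p 1 L ∧
        IsUnit (PowerSeries.coeff V.mordellWeilRank L))
    (hQshape : ∀ {N : ℕ} [NeZero N] {f : CuspForm (Gamma0 N) 2}, IsNewformOf V f →
      ∀ (ϖ : ℚ), (if Even (p / 2) then (ϖ : ℝ) * V.realPeriodRat = plusPeriod f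
          else (ϖ : ℝ) * V.imaginaryPeriodRat = minusPeriod f) →
      ∀ (Lη : IwasawaAlgebra p), IsQuadraticBranchPlusLFunction f p ϖ Lη →
        ∃ (u : IwasawaAlgebra p) (a : ℤ_[p]), IsUnit u ∧ (p : ℤ_[p]) ∣ a ∧ a ≠ 0 ∧
          Lη = u * PowerSeries.X ^ (V.quadraticTwist ((-1) ^ (p / 2) * p)).mordellWeilRank *
            (PowerSeries.X ^ 2 + PowerSeries.C a * PowerSeries.X + PowerSeries.C a))
    (htors : ∀ (K₀ : Type) [Field K₀] [NumberField K₀] [IsCyclotomicExtension {p} ℚ K₀]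
      [(galRange (K := ℚ) K₀).Normal] (ηq : absoluteGaloisGroup ℚ →* ℤˣ),
      (∀ σ ∈ galRange (K := ℚ) K₀, ηq σ = 1) → ηq ≠ 1 →
      ∀ (κ : ZpExtension ℚ p) (γ : absoluteGaloisGroup ℚ),
        κ.IsCyclotomic → κ.IsTopGenerator γ → γ ∈ galRange (K := ℚ) K₀ → IsCyclotomicVariable p γ →
      ∀ {N : ℕ} [NeZero N] {f : CuspForm (Gamma0 N) 2}, IsNewformOf V f →
      ∀ (ϖ : ℚ), (if Even (p / 2) then (ϖ : ℝ) * V.realPeriodRat = plusPeriod f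
          else (ϖ : ℝ) * V.imaginaryPeriodRat = minusPeriod f) →
      ∀ (Lη : IwasawaAlgebra p), IsQuadraticBranchPlusLFunction f p ϖ Lη →
        PowerSeries.coeff (V.quadraticTwist ((-1) ^ (p / 2) * p)).mordellWeilRank Lη ≠ 0 →
      ∀ (D : EtaSignedSelmerDualData V κ K₀ ℚ_[p] ηq γ 1),
        p ∣ Nat.card (AddCommGroup.torsion (IwasawaAlgebra.coinvariants p D.X))) :
    QuadraticBranchPlusEtaLowerInclusionAt V p ∧ QuadraticBranchPlusEtaMainConjectureAt V p := by
  refine quadraticBranchPlusEta_pair_of_namedFacts_of_invol_of_normShape_of_torsionDvd h12 h13 h22 h41 hKO hFE hp5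
    hgood hap hsurj (fun f hf => hcertV f hf) ?_ htors
  intro N _ f hf ϖ hϖ Lη hL
  obtain ⟨u, a, hu, ha, ha0, hLs⟩ := hQshape hf ϖ hϖ Lη hL
  refine ⟨u, Polynomial.X + Polynomial.C a, hu, isDistinguishedAt_X_add_C ha, ?_, ?_, ?_⟩
  · simpa using (Polynomial.prime_X_sub_C (-a)).irreducible
  · rwa [Polynomial.coeff_add, Polynomial.coeff_X_zero, Polynomial.coeff_C_zero, zero_add]
  · rw [hLs, one_add_X_mul_subst_X_add_C rfl]

end Pair

end Summit.BirchSwinnertonDyer.BirchSwinnertonDyer.Theorems.EtaThetaFunctionalEquation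

end
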